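import Summits.CriticalPhenomena.PercolationContinuityZ3.Theorems.PercNearOneGluingNoHeavyLowerTailSunflowerAntipodalGladkov
import Mathlib.Data.Fintype.Powerset
import HarnessLib
import HarnessLib.Audit

/-!
# `NoHeavyLowerTail` (crux stmt-CriticalPhenomena-4575), abstract sunflower cubic: the PARTITION LEMMA for monotone maps to `M₃`
# (typed conjecture), its open core "Lemma B", and the reduction `Lemma B ⇒ partition lemma` via antipodal Gladkov

Support file (seat `prim-ineq-prove-1` gen 25; `--supports stmt-CriticalPhenomena-4575`; companion of `…SunflowerAntipodalGladkov`).
Memo: run/shared/lean/prim/prim-ineq-prove-1/ABSTRACT-SUNFLOWER-CUBIC-prove1-g25.md.  The two `@[conjecture]` definitions are obligations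
of our theory, never facts: use them only as explicit hypotheses.

SETTING (`SunflowerPartition.Sunflower`, companion file): three up-sets of `2^α` with all pairwise intersections equal = a monotone map
`lab : 2^α → M₃` (`0` bottom `B`, `1,2,3` petals `C_i`, `4` top/kernel `A`).  An ORDERED 3-PARTITION of `α` is encoded as a disjoint pair
`(S,T)` with third block `(S ∪ T)ᶜ` (`parts`).

THE ROW.  For a product measure with cell masses `a, b, c₁, c₂, c₃` put `H := (a+b)(ab − e₂(c)) − e₃(c)` (percolation instances: `H_{q+t}`
on both three-point sunflowers, cert-2's `H4` on the pairing sunflower; `H ⇒ σ·AG − e₃ (AG⁺, G₄) ⇒ (σ+a)·AG − e₃ (3PT-LB, T_inc, γ)`).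
Six times its symmetric trilinear polarisation, evaluated on value triples, is the kernel `s6H`: `+2` on the multisets `{4,4,0}`, `{4,0,0}`,
`−1` on `{4,i,j}`, `{0,i,j}`, `{i,j,k}` (distinct petals), `0` otherwise.

* `PartitionLemmaH` (★, OPEN): `0 ≤ ZH := Σ_{ordered 3-partitions (P¹,P²,P³)} s6H (lab P¹) (lab P²) (lab P³)` for every finite `α` and every
  `Sunflower α`.  [= the tensor-Bernstein coefficients of `H` with profile in `{0,1}^α`.]  CLONING REDUCTION (memo §3, elementary, not
  formalised here): ★ for all finite ground sets implies `H ≥ 0` for EVERY product measure (replace each coordinate by `d` clones and `φ` by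
  `φ ∘ OR`; as `d → ∞` the three-copy expectation concentrates on triples that are ordered 3-partitions of the active clones) — hence `γ`,
  `G₄`, `H_{q+t}`, `AG⁺`, `T_inc`, `3PT-LB`.  CENSUS (memo §2): all monotone maps for `|α| ≤ 5` (1 160 928 at 5), random `|α| ≤ 7`,
  adversarial `|α| ≤ 10`: `ZH ≥ 0`, minimum `0`.
* DECOMPOSITION `s6H = vA + vB` with `vA x y z = 3·[x = 4]·kk y z` (kernel-block spectator × antipodal Gladkov kernel):
  `ZA := Σ vA ≥ 0` is PROVED (`ZA_nonneg`, from `Sunflower.antipodal_gladkov` of the companion file) — by block-relabelling symmetry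
  `ZA = 6·[N(A,A,B) − Σ_{i<j} N(C_i,C_j,A)]`, the memo's half "(a)".
* `PartitionLemmaB` (OPEN CORE): `0 ≤ ZB := Σ vB`; by block-relabelling symmetry `ZB = 6·[N(A,B,B) − Σ_{i<j} N(C_i,C_j,B) − N(C₁,C₂,C₃)]`
  ("top + two bottoms, minus the Gladkov debt at bottom spectators, pays for the all-distinct-petal partitions"); an IDENTITY (`= 0`) on every
  product instance (petals on disjoint ground sets), never violated in the census, tight ratio exactly `1`.
* `partitionLemmaH_of_B : PartitionLemmaB → PartitionLemmaH` (`ZH = ZA + ZB`).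
No-go data for proof architectures (2-copy row cone, one-coordinate induction at law and partition level, finite-type games, canonical
injections): memo §5.
-/

namespace Summit.CriticalPhenomena.PercolationContinuityZ3.Theorems.SunflowerPartition

open Finset

/-! ## Kernels on value triples -/

/-- `6 ×` the polarised `H`-row on value triples: `+2` on `{4,4,0}`, `{4,0,0}`; `−1` on `{4,i,j}`, `{0,i,j}`, `{i,j,k}` (distinct petals
`i,j,k`); `0` otherwise. [this work] -/
def s6H (x y z : Fin 5) : ℤ :=
  if (x = 4 ∧ y = 4 ∧ z = 0) ∨ (x = 4 ∧ y = 0 ∧ z = 4) ∨ (x = 0 ∧ y = 4 ∧ z = 4) ∨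
      (x = 4 ∧ y = 0 ∧ z = 0) ∨ (x = 0 ∧ y = 4 ∧ z = 0) ∨ (x = 0 ∧ y = 0 ∧ z = 4) then 2
  else if ((x ≠ 0 ∧ x ≠ 4) ∧ (y ≠ 0 ∧ y ≠ 4) ∧ x ≠ y ∧ z ≠ x ∧ z ≠ y) ∨
      ((x ≠ 0 ∧ x ≠ 4) ∧ (z ≠ 0 ∧ z ≠ 4) ∧ x ≠ z ∧ y ≠ x ∧ y ≠ z) ∨
      ((y ≠ 0 ∧ y ≠ 4) ∧ (z ≠ 0 ∧ z ≠ 4) ∧ y ≠ z ∧ x ≠ y ∧ x ≠ z) then -1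
  else 0

/-- The kernel-spectator part: `3 · [x = top] · kk y z`. [this work] -/
def vA (x y z : Fin 5) : ℤ := if x = 4 then 3 * kk y z else 0

/-- The remainder `s6H − vA` ("Lemma B" kernel). [this work] -/
def vB (x y z : Fin 5) : ℤ := s6H x y z - vA x y z

/-- `s6H` is symmetric (sanity). [this work] -/
theorem s6H_symm : ∀ x y z : Fin 5, s6H x y z = s6H y x z ∧ s6H x y z = s6H x z y := by decide

/-! ## Ordered 3-partitions and the three functionals -/

variable {α : Type*} [Fintype α] [DecidableEq α]

/-- Ordered 3-partitions `(P¹,P²,P³)` of `α`, encoded as disjoint pairs `(P¹,P²)` with `P³ = (P¹ ∪ P²)ᶜ`. [this work] -/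
def parts (α : Type*) [Fintype α] [DecidableEq α] : Finset (Finset α × Finset α) :=
  Finset.univ.filter fun q => Disjoint q.1 q.2

namespace Sunflower

variable (F : Sunflower α)

/-- `ZH = Σ_{ordered 3-partitions} s6H` (the partition functional of the `H`-row). [this work] -/
def ZH : ℤ := ∑ q ∈ parts α, s6H (F.lab q.1) (F.lab q.2) (F.lab (q.1 ∪ q.2)ᶜ)

/-- `ZA = Σ vA` (kernel-block spectator × antipodal Gladkov). [this work] -/
def ZA : ℤ := ∑ q ∈ parts α, vA (F.lab q.1) (F.lab q.2) (F.lab (q.1 ∪ q.2)ᶜ)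

/-- `ZB = Σ vB` (= `6 ×` the Lemma-B slack by block-relabelling symmetry). [this work] -/
def ZB : ℤ := ∑ q ∈ parts α, vB (F.lab q.1) (F.lab q.2) (F.lab (q.1 ∪ q.2)ᶜ)

/-- `ZH = ZA + ZB`. [this work] -/
theorem ZH_eq_ZA_add_ZB : F.ZH = F.ZA + F.ZB := by
  unfold ZH ZA ZB vB
  rw [← sum_add_distrib]
  refine sum_congr rfl fun q _ => ?_
  ring

omit [DecidableEq α] in
/-- Regrouping a sum over ordered 3-partitions by the first block: the second block runs over the subsets of its complement. [this work] -/
theorem sum_parts_eq [DecidableEq α] (f : Finset α → Finset α → ℤ) :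
    ∑ q ∈ parts α, f q.1 q.2 = ∑ S : Finset α, ∑ T ∈ (Sᶜ).powerset, f S T := by
  unfold parts
  rw [sum_filter, ← univ_product_univ, sum_product]
  refine sum_congr rfl fun S _ => ?_
  rw [← sum_filter]
  refine sum_congr ?_ fun _ _ => rfl
  ext T
  simp [mem_powerset, Finset.subset_compl_iff_disjoint_left]

/-- **`ZA ≥ 0`** — the half "(a)" of the partition lemma: with the kernel block as spectator, the other two blocks form an antipodal pair
in its complement, and `Sunflower.antipodal_gladkov` applies. [this work] -/
theorem ZA_nonneg : 0 ≤ F.ZA := by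
  unfold ZA vA
  rw [sum_parts_eq (f := fun S T => if F.lab S = 4 then 3 * kk (F.lab T) (F.lab (S ∪ T)ᶜ) else 0)]
  refine sum_nonneg fun S _ => ?_
  by_cases hS : F.lab S = 4
  · simp only [hS, if_true]
    rw [← mul_sum]
    refine mul_nonneg (by norm_num) ?_
    have h := F.antipodal_gladkov Sᶜ
    refine le_of_le_of_eq h (sum_congr rfl fun T hT => ?_)
    rw [compl_union, sdiff_eq_inter_compl, inter_comm]
  · simp [hS]

end Sunflower

/-! ## The typed conjectures and the reduction -/

/-- **PARTITION LEMMA for the abstract sunflower cubic** (this work; OPEN; census-clean exhaustively for ground sets of size `≤ 5`, memo §2):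
for every finite `α` and every sunflower of up-sets (monotone map `2^α → M₃`), `Σ_{ordered 3-partitions} s6H ≥ 0`.  By the cloning reduction
(memo §3) it implies `(a+b)(ab − e₂(c)) ≥ e₃(c)` for every product measure, hence `γ`, `G₄`, `H_{q+t}`, `AG⁺`, `T_inc`, `3PT-LB`.
An obligation, never a fact: use as `(h : PartitionLemmaH)`. [status: open] -/
@[conjecture] def PartitionLemmaH : Prop :=
  ∀ (α : Type) [Fintype α] [DecidableEq α] (F : Sunflower α), 0 ≤ F.ZH

/-- **LEMMA B** (this work; OPEN CORE): `Σ_{ordered 3-partitions} vB ≥ 0`, i.e. (by block-relabelling symmetry)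
`N(A,B,B) − Σ_{i<j} N(C_i,C_j,B) ≥ N(C₁,C₂,C₃)` — an identity on product instances, never violated in the census (memo §4(b)).
An obligation, never a fact: use as `(h : PartitionLemmaB)`. [status: open] -/
@[conjecture] def PartitionLemmaB : Prop :=
  ∀ (α : Type) [Fintype α] [DecidableEq α] (F : Sunflower α), 0 ≤ F.ZB

/-- **Reduction**: Lemma B implies the partition lemma (`ZH = ZA + ZB`, `ZA ≥ 0`). [this work] -/
theorem partitionLemmaH_of_B (h : PartitionLemmaB) : PartitionLemmaH := by
  intro α _ _ F
  rw [F.ZH_eq_ZA_add_ZB]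
  exact add_nonneg F.ZA_nonneg (h α F)

end Summit.CriticalPhenomena.PercolationContinuityZ3.Theorems.SunflowerPartition
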